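/-
Copyright (c) 2026 the pub-hodgecm-mathlib formalisation cell (harness21).  Prover seat hodgecm-mathlib-F0P3a-p01 (g37), FLOOR 0, SUPPORTS-ONLY on h413; β-BOARD v1 R10
(assembler ∕ chair): THE HANGING-LINE TWINS — the boundary (type-two) and below-boundary H rows of the placements `n₂ = n₃` and `n₁ = n₃` from the placement `n₁ = n₂`
by ★ p862014's `(0 2) ∘ α⁻¹` and ★ p861439's `(0 1)` transports.  2026-09-04.
-/
import Summits.HodgeConjecture.HodgeConjecture.Theorems.F0P3cDyRamLabelledOddTowerThreeOfTowerOne    -- ★ p862014 (LH7-p07 (g0)): `finsum_stratum_shell_labelledOdd_div_relIndex_swap02_of`, `levels_le_n0DerivedOfRecord`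
import Summits.HodgeConjecture.HodgeConjecture.Theorems.F0P3cDyRamTowerSignTokenRescale             -- ★ p862115 (LH7-p07 (g0)): `token_neg`, `token_inv_sub_one_of_token_sub_one`, `token_mul_inv_sub_one_of_token_sub`
import Summits.HodgeConjecture.HodgeConjecture.Theorems.F0P3cDyRamDiagonalKappaSplitCountEval       -- ★: `normSign_mul_self`
import Summits.HodgeConjecture.HodgeConjecture.Theorems.F0P3cDyRamDiagonalKappaCoreHangingClass     -- ★: `two_le_d_of_v_two_lt_one`
import Literature.NumberTheory.LocalFields.WildQuadraticDatumNormSignConductor                      -- ★: `normSign_mul_of_fixed`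
import HarnessLib

/-!
# Crux `H413`, LH4 «(D-RAM) FOUR-FRAME» road, STAGE 1b (β) — THE HANGING-LINE TWINS: the H rows of the placements `n₂ = n₃`, `n₁ = n₃` from the placement `n₁ = n₂`

Cell `hodgecm-mathlib` (D-0151), FLOOR 0, crux item H413 = `stmt-HodgeConjecture-24833`, route `HCCMUnconditional`; squad F0∕P3c∕LH4.  THEOREMS ONLY (no `def`, no instance, no
notation, no `sorry`, default heartbeats); ★-only imports; lane `--supports stmt-HodgeConjecture-24833 --as helper` (count-neutral; pays NO row).

WHAT THIS FILE DOES (chair's LEDGER #19 (iv)(v)).  LH4-p05 (g9)'s ★ p861984 H-line junction `hangingValue_of_rows` carries the not-yet-★ H rows as binders per PLACEMENT of the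
isosceles key: the boundary rows `hB₃` (`n₁ = n₂`, `n₃ + 2 = n₁ + 2d`), `hB₂` (`n₁ = n₃`), `hB₁` (`n₂ = n₃`) and the below-boundary zeros `hZ₃`, `hZ₂`, `hZ₁`.  LH7-p08 (g0) types
the placement `n₁ = n₂` (key `(m, m, L)`).  The core-hanging stratum `(2ρ, 2ρ, 2ρ)` is its own image under every coordinate permutation, so the other two placements FOLLOW:
`(m, m, L) ↦ (L, m, m)` under ★ p862014's `(0 2) ∘ α⁻¹` (datum `(α⁻¹, βα⁻¹; n₃, n₂, n₁)`, slot `(0 2) i`, tokens `eA″ = −e_A`, `eB″ = e_C` by ★ p862115), and `(L, m, m) ↦ (m, L, m)`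
under ★ p861439's `(0 1)` (datum `(β, α; n₂, n₁, n₃)`, slot `(0 1) i`, tokens `eA′ = e_B`, `eC′ = −e_C`).  §1–§2: `hB₁` from the ∀-datum `hB₃` schema, `hB₂` from the ∀-datum
`hB₁` schema (values `−(ω_A + ω(−1)ω_C)` in slot 0, `−(ω_B + ω_C)` in slot 1, from `−(ω(−1)ω_B + ω(−1)ω_A)` in slot 2 — `ω(−e) = ω(−1)ω(e)`, `ω(−1)² = 1`); §3–§4: `hZ₁` from
the `hZ₃` schema, `hZ₂` from the `hZ₁` schema (token-free).  Binder texts = ★ p861984's, ∀-closed over the element datum at the derived threshold and its tokens.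
HONEST LABEL.  Count-neutral transports; the `n₁ = n₂` rows are hypotheses here; `hRest`, (β) OPEN; `HC_CM` is proved only modulo the 7 printed citations (2 remaining named
inputs: hLiu418 = `stmt-HodgeConjecture-24832`, h413 = `stmt-HodgeConjecture-24833`) until rung 0 closes.

## References
* [Kottwitz1986BaseChangeUnits] R. E. Kottwitz, *Base change for unit elements of Hecke algebras*, Compositio Math. 60 (1986), §1 pp. 240–241 (lattice counts modulo the
  diagonal torus; symmetry in the coordinates of the split torus).
* [Rogawski1990] J. D. Rogawski, *Automorphic Representations of Unitary Groups in Three Variables*, Ann. of Math. Stud. 123 (1990), §4.9 Prop. 4.9.1 (a)(b) p. 55, §4.10 p. 58.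
* [Serre1979] J.-P. Serre, *Local Fields*, GTM 67, Springer (1979), Ch. V §3 (the norm residue character).
-/

set_option autoImplicit false

noncomputable section

namespace Summit.HodgeConjecture.HodgeConjecture.Cruxes.H413.F0P3cDyRamOddLabelledHangingTwins

open Matrix
open Literature.NumberTheory.Automorphic Literature.NumberTheory.Automorphic.HermitianLattice
open Literature.NumberTheory.Automorphic.UnitaryLatticeTree Literature.NumberTheory.Automorphic.UnitaryThreeFourFrame
open Literature.NumberTheory.LocalFields Literature.NumberTheory.LocalFields.WildQuadraticDatum
open Summit.HodgeConjecture.HodgeConjecture.Cruxes.H413.F0P3cDyRamFourFramePieces (mstarOfRecord)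
open Summit.HodgeConjecture.HodgeConjecture.Cruxes.H413.F0P3cDyRamFourFrameCensusDefs (LatticeInLevel)
open Summit.HodgeConjecture.HodgeConjecture.Cruxes.H413.F0P3cDyRamStageOneBDefs (mcOfRecord mstarOfRecord_le_mcOfRecord)
open Summit.HodgeConjecture.HodgeConjecture.Cruxes.H413.F0P3cDyRamStageOneBDerivedDefs (n0DerivedOfRecord mcOfRecord_le_n0DerivedOfRecord)
open Summit.HodgeConjecture.HodgeConjecture.Cruxes.H413.F0P3cDyRamDiagonalTorusDefs
open Summit.HodgeConjecture.HodgeConjecture.Cruxes.H413.F0P3cDyRamDiagonalStrataDefs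
open Summit.HodgeConjecture.HodgeConjecture.Cruxes.H413.F0P3cDyRamLabelledOddCountDefs
open Summit.HodgeConjecture.HodgeConjecture.Cruxes.H413.F0P3cDyRamLabelledOddSwapEngine (finsum_stratum_shell_labelledOdd_div_relIndex_swap01_of)
open Summit.HodgeConjecture.HodgeConjecture.Cruxes.H413.F0P3cDyRamLabelledOddTowerThreeOfTowerOne (finsum_stratum_shell_labelledOdd_div_relIndex_swap02_of levels_le_n0DerivedOfRecord)
open Summit.HodgeConjecture.HodgeConjecture.Cruxes.H413.F0P3cDyRamTowerSignTokenRescale (token_neg token_inv_sub_one_of_token_sub_one token_mul_inv_sub_one_of_token_sub)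
open Summit.HodgeConjecture.HodgeConjecture.Cruxes.H413.F0P3cDyRamDiagonalKappaSplitCountEval (normSign_mul_self)
open Summit.HodgeConjecture.HodgeConjecture.Cruxes.H413.F0P3cDyRamDiagonalKappaCoreHangingClass (two_le_d_of_v_two_lt_one)
open scoped Valued WithZero Matrix MatrixGroups

variable {K : Type} [Field K] [Valued K ℤᵐ⁰] {σ : K →+* K} {ϖ : K} {d t : ℕ} {α β : K} {n₁ n₂ n₃ : ℕ}

/-! ## §1  The boundary row of the placement `n₂ = n₃` from the placement `n₁ = n₂` (`(0 2) ∘ α⁻¹`) -/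

/-- **`hB₁` FROM THE `hB₃` SCHEMA.**  If at every element datum at the derived threshold (tokens `eA'` of `α' − 1` at `n₂'`, `eB'` of `β' − 1` at `n₁'`) the boundary H row of the
placement `n₁' = n₂'`, `n₃' + 2 = n₁' + 2d` holds — `v'_i(2ρ,2ρ,2ρ) = (0, 0, −(ω(−1)ω(eB') + ω(−1)ω(eA')))_i ∕ 2 · q^{2ρ−1}` on `2ρ + ℓ₀ = n₁'` — then at `(α, β; n₁, n₂, n₃)`
with tokens `eA`, `eC` the boundary H row of the placement `n₂ = n₃`, `n₁ + 2 = n₂ + 2d` holds: `v_i = (−(ω_A + ω(−1)ω_C), 0, 0)_i ∕ 2 · q^{2ρ−1}` on `2ρ + ℓ₀ = n₂` — ★ p861984's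
`hB₁` binder VERBATIM (★ p862014 at the rescaled datum `(α⁻¹, βα⁻¹; n₃, n₂, n₁)`, tokens `(−eA, eC)`). [cite: Kottwitz1986BaseChangeUnits, §1 pp. 240–241]
[cite: Rogawski1990, §4.9 Prop. 4.9.1 (a)(b) p. 55, §4.10 p. 58] [cite: Serre1979, Ch. V §3] -/
theorem boundary₁_of_boundary₃ [CompleteSpace K] [Fintype 𝓀[K]] (h2 : Valued.v (2 : K) < 1) (hD : IsRamifiedQuadraticDatum σ ϖ d t)
    (hB₃ : ∀ {α' β' : K} {n₁' n₂' n₃' : ℕ} (T' : GL (Fin 3) K) (eA' eB' : K), IsElementDatum σ ϖ (n0DerivedOfRecord d) α' β' n₁' n₂' n₃' →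
      (T' : Matrix (Fin 3) (Fin 3) K) = Matrix.diagonal ![α', β', 1] →
      σ eA' = eA' → Valued.v eA' = 1 → Valued.v ((ϖ ^ mstarOfRecord d)⁻¹ * ((α' - 1) * ((ϖ * σ ϖ) ^ ((n₂' - d % 2) / 2))⁻¹ - eA' * ((ϖ - σ ϖ) * ((ϖ * σ ϖ) ^ ((d - d % 2) / 2))⁻¹))) ≤ 1 →
      σ eB' = eB' → Valued.v eB' = 1 → Valued.v ((ϖ ^ mstarOfRecord d)⁻¹ * ((β' - 1) * ((ϖ * σ ϖ) ^ ((n₁' - d % 2) / 2))⁻¹ - eB' * ((ϖ - σ ϖ) * ((ϖ * σ ϖ) ^ ((d - d % 2) / 2))⁻¹))) ≤ 1 →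
      n₁' = n₂' → n₃' + 2 = n₁' + 2 * d → ∀ ρ : ℕ, 1 ≤ ρ → 2 * ρ + d % 2 = n₁' → ∀ i : Fin 3,
        ∑ᶠ M ∈ {M : Submodule 𝒪[K] (Fin 3 → K) | M ∈ stratum σ ϖ T' ![2 * ρ, 2 * ρ, 2 * ρ] ∧
            (LatticeInLevel ϖ (d % 2) (Matrix.diagonal ![α' - 1, β' - 1, 0]) M ∧ ¬ LatticeInLevel ϖ (d % 2 + 1) (Matrix.diagonal ![α' - 1, β' - 1, 0]) M ∧
              LatticeInLevel ϖ (mcOfRecord d) (Matrix.diagonal ![(α' - 1) * (α' - 1), (β' - 1) * (β' - 1), 0]) M)},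
          (labelledOddCount σ ϖ 0 i (valueClassLabel σ ϖ (α' - 1) (β' - 1) (mstarOfRecord d) d) M : ℚ) /
            ((((unitStabilizer M).map (unitNormMap σ 3)).relIndex (fixedUnitTorus σ 3) : ℕ) : ℚ) =
        (((![0, 0, -(normSign σ (-1 : K) * normSign σ eB' + normSign σ (-1 : K) * normSign σ eA')] : Fin 3 → ℤ) i : ℤ) : ℚ) / 2 * (Nat.card 𝓀[K] : ℚ) ^ (2 * ρ - 1))
    (hE : IsElementDatum σ ϖ (n0DerivedOfRecord d) α β n₁ n₂ n₃)
    (T : GL (Fin 3) K) (hT : (T : Matrix (Fin 3) (Fin 3) K) = Matrix.diagonal ![α, β, 1])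
    {eA eC : K} (hσeA : σ eA = eA) (heA1 : Valued.v eA = 1) (heA : Valued.v ((ϖ ^ mstarOfRecord d)⁻¹ * ((α - 1) * ((ϖ * σ ϖ) ^ ((n₂ - d % 2) / 2))⁻¹ - eA * ((ϖ - σ ϖ) * ((ϖ * σ ϖ) ^ ((d - d % 2) / 2))⁻¹))) ≤ 1)
    (hσeC : σ eC = eC) (heC1 : Valued.v eC = 1) (heC : Valued.v ((ϖ ^ mstarOfRecord d)⁻¹ * ((β - α) * ((ϖ * σ ϖ) ^ ((n₃ - d % 2) / 2))⁻¹ - eC * ((ϖ - σ ϖ) * ((ϖ * σ ϖ) ^ ((d - d % 2) / 2))⁻¹))) ≤ 1) :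
    n₂ = n₃ → n₁ + 2 = n₂ + 2 * d → ∀ ρ : ℕ, 1 ≤ ρ → 2 * ρ + d % 2 = n₂ → ∀ i : Fin 3,
      ∑ᶠ M ∈ {M : Submodule 𝒪[K] (Fin 3 → K) | M ∈ stratum σ ϖ T ![2 * ρ, 2 * ρ, 2 * ρ] ∧
          (LatticeInLevel ϖ (d % 2) (Matrix.diagonal ![α - 1, β - 1, 0]) M ∧ ¬ LatticeInLevel ϖ (d % 2 + 1) (Matrix.diagonal ![α - 1, β - 1, 0]) M ∧
            LatticeInLevel ϖ (mcOfRecord d) (Matrix.diagonal ![(α - 1) * (α - 1), (β - 1) * (β - 1), 0]) M)},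
        (labelledOddCount σ ϖ 0 i (valueClassLabel σ ϖ (α - 1) (β - 1) (mstarOfRecord d) d) M : ℚ) /
          ((((unitStabilizer M).map (unitNormMap σ 3)).relIndex (fixedUnitTorus σ 3) : ℕ) : ℚ) =
      (((![-(normSign σ eA + normSign σ (-1 : K) * normSign σ eC), 0, 0] : Fin 3 → ℤ) i : ℤ) : ℚ) / 2 * (Nat.card 𝓀[K] : ℚ) ^ (2 * ρ - 1) := by
  intro h23 hbd ρ hρ hloc i
  have h2d : 2 ≤ d := two_le_d_of_v_two_lt_one hD h2
  obtain ⟨hℓ, hℓ', hmcN, hmN⟩ := levels_le_n0DerivedOfRecord (d := d) (by omega)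
  -- the tokens of the rescaled datum: `−eA` for `α⁻¹ − 1` at `n₂`, `eC` for `βα⁻¹ − 1` at `n₃`
  have hσnA : σ (-eA) = -eA := by rw [map_neg, hσeA]
  have hnA1 : Valued.v (-eA) = 1 := by rw [Valuation.map_neg, heA1]
  have hnA := token_inv_sub_one_of_token_sub_one hD hE hmN heA1.le _ heA
  have hnC : Valued.v ((ϖ ^ mstarOfRecord d)⁻¹ * ((β * α⁻¹ - 1) * ((ϖ * σ ϖ) ^ ((n₃ - d % 2) / 2))⁻¹ - eC * ((ϖ - σ ϖ) * ((ϖ * σ ϖ) ^ ((d - d % 2) / 2))⁻¹))) ≤ 1 := by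
    have h0 := token_neg heC
    rw [neg_sub] at h0
    have h := token_mul_inv_sub_one_of_token_sub hD hE hmN (eC := -eC) (by rw [Valuation.map_neg]; exact heC1.le) _ h0
    rwa [neg_neg] at h
  -- ★ p862014's engine at `(a, b, c) = (2ρ, 2ρ, 2ρ)`, witness `(−eA, eC)`
  have key := finsum_stratum_shell_labelledOdd_div_relIndex_swap02_of hD hE hT 0 (2 * ρ) (2 * ρ) (2 * ρ) hℓ hℓ' hmcN hmN (W := K × K)
    (fun α' β' n₁' n₂' n₃' w => σ w.1 = w.1 ∧ Valued.v w.1 = 1 ∧ Valued.v ((ϖ ^ mstarOfRecord d)⁻¹ * ((α' - 1) * ((ϖ * σ ϖ) ^ ((n₂' - d % 2) / 2))⁻¹ - w.1 * ((ϖ - σ ϖ) * ((ϖ * σ ϖ) ^ ((d - d % 2) / 2))⁻¹))) ≤ 1 ∧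
      σ w.2 = w.2 ∧ Valued.v w.2 = 1 ∧ Valued.v ((ϖ ^ mstarOfRecord d)⁻¹ * ((β' - 1) * ((ϖ * σ ϖ) ^ ((n₁' - d % 2) / 2))⁻¹ - w.2 * ((ϖ - σ ϖ) * ((ϖ * σ ϖ) ^ ((d - d % 2) / 2))⁻¹))) ≤ 1 ∧
      n₁' = n₂' ∧ n₃' + 2 = n₁' + 2 * d ∧ 2 * ρ + d % 2 = n₁')
    (fun α' β' n₁' n₂' n₃' w i => (((![0, 0, -(normSign σ (-1 : K) * normSign σ w.2 + normSign σ (-1 : K) * normSign σ w.1)] : Fin 3 → ℤ) i : ℤ) : ℚ) / 2 *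
      (Nat.card 𝓀[K] : ℚ) ^ (2 * ρ - 1))
    (fun T' w hE' hT' hHyp j => hB₃ T' w.1 w.2 hE' hT' hHyp.1 hHyp.2.1 hHyp.2.2.1 hHyp.2.2.2.1 hHyp.2.2.2.2.1 hHyp.2.2.2.2.2.1
      hHyp.2.2.2.2.2.2.1 hHyp.2.2.2.2.2.2.2.1 ρ hρ hHyp.2.2.2.2.2.2.2.2 j)
    (-eA, eC) ⟨hσnA, hnA1, hnA, hσeC, heC1, hnC, h23.symm, by omega, by omega⟩ i
  rw [key]
  -- `ω(−eA) = ω(−1)·ω(eA)`, `ω(−1)·ω(−1) = 1`, then the slot swap `(0, 0, x)` at `(0 2) i` is `(x, 0, 0)` at `i`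
  have hσ1 : σ (-1 : K) = -1 := by rw [map_neg, map_one]
  have heA0 : eA ≠ 0 := fun h => by rw [h, map_zero] at heA1; exact zero_ne_one heA1
  have hneg : normSign σ (-eA) = normSign σ (-1 : K) * normSign σ eA := by
    rw [← neg_one_mul eA, normSign_mul_of_fixed hD hσ1 hσeA (neg_ne_zero.2 one_ne_zero) heA0]
  have hcoef : -(normSign σ (-1 : K) * normSign σ eC + normSign σ (-1 : K) * normSign σ (-eA)) = -(normSign σ eA + normSign σ (-1 : K) * normSign σ eC) := by
    rw [hneg, ← mul_assoc, normSign_mul_self, one_mul, add_comm]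
  simp only [hcoef]
  fin_cases i <;> rfl

/-! ## §2  The boundary row of the placement `n₁ = n₃` from the placement `n₂ = n₃` (`(0 1)`) -/

/-- **`hB₂` FROM THE `hB₁` SCHEMA.**  If at every element datum at the derived threshold (tokens `eA'` of `α' − 1` at `n₂'`, `eC'` of `β' − α'` at `n₃'`) the boundary H row of
the placement `n₂' = n₃'`, `n₁' + 2 = n₂' + 2d` holds — `v'_i = (−(ω(eA') + ω(−1)ω(eC')), 0, 0)_i ∕ 2 · q^{2ρ−1}` on `2ρ + ℓ₀ = n₂'` — then at `(α, β; n₁, n₂, n₃)` with tokens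
`eB`, `eC` the boundary H row of the placement `n₁ = n₃`, `n₂ + 2 = n₁ + 2d` holds: `v_i = (0, −(ω_B + ω_C), 0)_i ∕ 2 · q^{2ρ−1}` on `2ρ + ℓ₀ = n₁` — ★ p861984's `hB₂` binder
VERBATIM (★ p861439 at the swapped datum `(β, α; n₂, n₁, n₃)`, tokens `(eB, −eC)`). [cite: Kottwitz1986BaseChangeUnits, §1 pp. 240–241]
[cite: Rogawski1990, §4.9 Prop. 4.9.1 (a)(b) p. 55, §4.10 p. 58] [cite: Serre1979, Ch. V §3] -/
theorem boundary₂_of_boundary₁ [CompleteSpace K] [Fintype 𝓀[K]] (hD : IsRamifiedQuadraticDatum σ ϖ d t)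
    (hB₁ : ∀ {α' β' : K} {n₁' n₂' n₃' : ℕ} (T' : GL (Fin 3) K) (eA' eC' : K), IsElementDatum σ ϖ (n0DerivedOfRecord d) α' β' n₁' n₂' n₃' →
      (T' : Matrix (Fin 3) (Fin 3) K) = Matrix.diagonal ![α', β', 1] →
      σ eA' = eA' → Valued.v eA' = 1 → Valued.v ((ϖ ^ mstarOfRecord d)⁻¹ * ((α' - 1) * ((ϖ * σ ϖ) ^ ((n₂' - d % 2) / 2))⁻¹ - eA' * ((ϖ - σ ϖ) * ((ϖ * σ ϖ) ^ ((d - d % 2) / 2))⁻¹))) ≤ 1 →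
      σ eC' = eC' → Valued.v eC' = 1 → Valued.v ((ϖ ^ mstarOfRecord d)⁻¹ * ((β' - α') * ((ϖ * σ ϖ) ^ ((n₃' - d % 2) / 2))⁻¹ - eC' * ((ϖ - σ ϖ) * ((ϖ * σ ϖ) ^ ((d - d % 2) / 2))⁻¹))) ≤ 1 →
      n₂' = n₃' → n₁' + 2 = n₂' + 2 * d → ∀ ρ : ℕ, 1 ≤ ρ → 2 * ρ + d % 2 = n₂' → ∀ i : Fin 3,
        ∑ᶠ M ∈ {M : Submodule 𝒪[K] (Fin 3 → K) | M ∈ stratum σ ϖ T' ![2 * ρ, 2 * ρ, 2 * ρ] ∧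
            (LatticeInLevel ϖ (d % 2) (Matrix.diagonal ![α' - 1, β' - 1, 0]) M ∧ ¬ LatticeInLevel ϖ (d % 2 + 1) (Matrix.diagonal ![α' - 1, β' - 1, 0]) M ∧
              LatticeInLevel ϖ (mcOfRecord d) (Matrix.diagonal ![(α' - 1) * (α' - 1), (β' - 1) * (β' - 1), 0]) M)},
          (labelledOddCount σ ϖ 0 i (valueClassLabel σ ϖ (α' - 1) (β' - 1) (mstarOfRecord d) d) M : ℚ) /
            ((((unitStabilizer M).map (unitNormMap σ 3)).relIndex (fixedUnitTorus σ 3) : ℕ) : ℚ) =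
        (((![-(normSign σ eA' + normSign σ (-1 : K) * normSign σ eC'), 0, 0] : Fin 3 → ℤ) i : ℤ) : ℚ) / 2 * (Nat.card 𝓀[K] : ℚ) ^ (2 * ρ - 1))
    (hE : IsElementDatum σ ϖ (n0DerivedOfRecord d) α β n₁ n₂ n₃)
    (T : GL (Fin 3) K) (hT : (T : Matrix (Fin 3) (Fin 3) K) = Matrix.diagonal ![α, β, 1])
    {eB eC : K} (hσeB : σ eB = eB) (heB1 : Valued.v eB = 1) (heB : Valued.v ((ϖ ^ mstarOfRecord d)⁻¹ * ((β - 1) * ((ϖ * σ ϖ) ^ ((n₁ - d % 2) / 2))⁻¹ - eB * ((ϖ - σ ϖ) * ((ϖ * σ ϖ) ^ ((d - d % 2) / 2))⁻¹))) ≤ 1)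
    (hσeC : σ eC = eC) (heC1 : Valued.v eC = 1) (heC : Valued.v ((ϖ ^ mstarOfRecord d)⁻¹ * ((β - α) * ((ϖ * σ ϖ) ^ ((n₃ - d % 2) / 2))⁻¹ - eC * ((ϖ - σ ϖ) * ((ϖ * σ ϖ) ^ ((d - d % 2) / 2))⁻¹))) ≤ 1) :
    n₁ = n₃ → n₂ + 2 = n₁ + 2 * d → ∀ ρ : ℕ, 1 ≤ ρ → 2 * ρ + d % 2 = n₁ → ∀ i : Fin 3,
      ∑ᶠ M ∈ {M : Submodule 𝒪[K] (Fin 3 → K) | M ∈ stratum σ ϖ T ![2 * ρ, 2 * ρ, 2 * ρ] ∧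
          (LatticeInLevel ϖ (d % 2) (Matrix.diagonal ![α - 1, β - 1, 0]) M ∧ ¬ LatticeInLevel ϖ (d % 2 + 1) (Matrix.diagonal ![α - 1, β - 1, 0]) M ∧
            LatticeInLevel ϖ (mcOfRecord d) (Matrix.diagonal ![(α - 1) * (α - 1), (β - 1) * (β - 1), 0]) M)},
        (labelledOddCount σ ϖ 0 i (valueClassLabel σ ϖ (α - 1) (β - 1) (mstarOfRecord d) d) M : ℚ) /
          ((((unitStabilizer M).map (unitNormMap σ 3)).relIndex (fixedUnitTorus σ 3) : ℕ) : ℚ) =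
      (((![0, -(normSign σ eB + normSign σ eC), 0] : Fin 3 → ℤ) i : ℤ) : ℚ) / 2 * (Nat.card 𝓀[K] : ℚ) ^ (2 * ρ - 1) := by
  intro h13 hbd ρ hρ hloc i
  -- the token of `α − β = −(β − α)` at depth `n₃` is `−eC`
  have hσnC : σ (-eC) = -eC := by rw [map_neg, hσeC]
  have hnC1 : Valued.v (-eC) = 1 := by rw [Valuation.map_neg, heC1]
  have hnC : Valued.v ((ϖ ^ mstarOfRecord d)⁻¹ * ((α - β) * ((ϖ * σ ϖ) ^ ((n₃ - d % 2) / 2))⁻¹ - (-eC) * ((ϖ - σ ϖ) * ((ϖ * σ ϖ) ^ ((d - d % 2) / 2))⁻¹))) ≤ 1 := by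
    have h : (ϖ ^ mstarOfRecord d)⁻¹ * ((α - β) * ((ϖ * σ ϖ) ^ ((n₃ - d % 2) / 2))⁻¹ - (-eC) * ((ϖ - σ ϖ) * ((ϖ * σ ϖ) ^ ((d - d % 2) / 2))⁻¹)) =
        -((ϖ ^ mstarOfRecord d)⁻¹ * ((β - α) * ((ϖ * σ ϖ) ^ ((n₃ - d % 2) / 2))⁻¹ - eC * ((ϖ - σ ϖ) * ((ϖ * σ ϖ) ^ ((d - d % 2) / 2))⁻¹))) := by ring
    rw [h, Valuation.map_neg]; exact heC
  -- ★ p861439's engine at `(a, b, c) = (2ρ, 2ρ, 2ρ)`, witness `(eB, −eC)`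
  have key := finsum_stratum_shell_labelledOdd_div_relIndex_swap01_of hE hT 0 (2 * ρ) (2 * ρ) (2 * ρ) (d % 2) (d % 2 + 1)
    (mcOfRecord d) (mstarOfRecord d) d (W := K × K)
    (fun α' β' n₁' n₂' n₃' w => σ w.1 = w.1 ∧ Valued.v w.1 = 1 ∧ Valued.v ((ϖ ^ mstarOfRecord d)⁻¹ * ((α' - 1) * ((ϖ * σ ϖ) ^ ((n₂' - d % 2) / 2))⁻¹ - w.1 * ((ϖ - σ ϖ) * ((ϖ * σ ϖ) ^ ((d - d % 2) / 2))⁻¹))) ≤ 1 ∧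
      σ w.2 = w.2 ∧ Valued.v w.2 = 1 ∧ Valued.v ((ϖ ^ mstarOfRecord d)⁻¹ * ((β' - α') * ((ϖ * σ ϖ) ^ ((n₃' - d % 2) / 2))⁻¹ - w.2 * ((ϖ - σ ϖ) * ((ϖ * σ ϖ) ^ ((d - d % 2) / 2))⁻¹))) ≤ 1 ∧
      n₂' = n₃' ∧ n₁' + 2 = n₂' + 2 * d ∧ 2 * ρ + d % 2 = n₂')
    (fun α' β' n₁' n₂' n₃' w i => (((![-(normSign σ w.1 + normSign σ (-1 : K) * normSign σ w.2), 0, 0] : Fin 3 → ℤ) i : ℤ) : ℚ) / 2 *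
      (Nat.card 𝓀[K] : ℚ) ^ (2 * ρ - 1))
    (fun T' w hE' hT' hHyp j => hB₁ T' w.1 w.2 hE' hT' hHyp.1 hHyp.2.1 hHyp.2.2.1 hHyp.2.2.2.1 hHyp.2.2.2.2.1 hHyp.2.2.2.2.2.1
      hHyp.2.2.2.2.2.2.1 hHyp.2.2.2.2.2.2.2.1 ρ hρ hHyp.2.2.2.2.2.2.2.2 j)
    (eB, -eC) ⟨hσeB, heB1, heB, hσnC, hnC1, hnC, h13, hbd, hloc⟩ i
  rw [key]
  have hσ1 : σ (-1 : K) = -1 := by rw [map_neg, map_one]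
  have heC0 : eC ≠ 0 := fun h => by rw [h, map_zero] at heC1; exact zero_ne_one heC1
  have hneg : normSign σ (-eC) = normSign σ (-1 : K) * normSign σ eC := by
    rw [← neg_one_mul eC, normSign_mul_of_fixed hD hσ1 hσeC (neg_ne_zero.2 one_ne_zero) heC0]
  have hcoef : -(normSign σ eB + normSign σ (-1 : K) * normSign σ (-eC)) = -(normSign σ eB + normSign σ eC) := by
    rw [hneg, ← mul_assoc, normSign_mul_self, one_mul]
  simp only [hcoef]
  fin_cases i <;> rfl

/-! ## §3  The below-boundary zero of the placement `n₂ = n₃` from the placement `n₁ = n₂` (`(0 2) ∘ α⁻¹`) -/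

/-- **`hZ₁` FROM THE `hZ₃` SCHEMA** (token-free): if at every element datum at the derived threshold the H row vanishes on the locus `2ρ + ℓ₀ = n₁'` of the placement `n₁' = n₂' < n₃'`
with `n₃' + 4 ≤ n₁' + 2d`, then at `(α, β; n₁, n₂, n₃)` it vanishes on the locus `2ρ + ℓ₀ = n₂` of the placement `n₂ = n₃ < n₁` with `n₁ + 4 ≤ n₂ + 2d` — ★ p861984's `hZ₁`
binder VERBATIM (★ p862014 at `(α⁻¹, βα⁻¹; n₃, n₂, n₁)`). [cite: Kottwitz1986BaseChangeUnits, §1 pp. 240–241] [cite: Rogawski1990, §4.9 Prop. 4.9.1 (a)(b) p. 55] -/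
theorem zero₁_of_zero₃ (h2 : Valued.v (2 : K) < 1) (hD : IsRamifiedQuadraticDatum σ ϖ d t)
    (hZ₃ : ∀ {α' β' : K} {n₁' n₂' n₃' : ℕ} (T' : GL (Fin 3) K), IsElementDatum σ ϖ (n0DerivedOfRecord d) α' β' n₁' n₂' n₃' →
      (T' : Matrix (Fin 3) (Fin 3) K) = Matrix.diagonal ![α', β', 1] →
      n₁' = n₂' → n₁' < n₃' → n₃' + 4 ≤ n₁' + 2 * d → ∀ ρ : ℕ, 1 ≤ ρ → 2 * ρ + d % 2 = n₁' → ∀ i : Fin 3,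
        ∑ᶠ M ∈ {M : Submodule 𝒪[K] (Fin 3 → K) | M ∈ stratum σ ϖ T' ![2 * ρ, 2 * ρ, 2 * ρ] ∧
            (LatticeInLevel ϖ (d % 2) (Matrix.diagonal ![α' - 1, β' - 1, 0]) M ∧ ¬ LatticeInLevel ϖ (d % 2 + 1) (Matrix.diagonal ![α' - 1, β' - 1, 0]) M ∧
              LatticeInLevel ϖ (mcOfRecord d) (Matrix.diagonal ![(α' - 1) * (α' - 1), (β' - 1) * (β' - 1), 0]) M)},
          (labelledOddCount σ ϖ 0 i (valueClassLabel σ ϖ (α' - 1) (β' - 1) (mstarOfRecord d) d) M : ℚ) /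
            ((((unitStabilizer M).map (unitNormMap σ 3)).relIndex (fixedUnitTorus σ 3) : ℕ) : ℚ) = 0)
    (hE : IsElementDatum σ ϖ (n0DerivedOfRecord d) α β n₁ n₂ n₃)
    (T : GL (Fin 3) K) (hT : (T : Matrix (Fin 3) (Fin 3) K) = Matrix.diagonal ![α, β, 1]) :
    n₂ = n₃ → n₂ < n₁ → n₁ + 4 ≤ n₂ + 2 * d → ∀ ρ : ℕ, 1 ≤ ρ → 2 * ρ + d % 2 = n₂ → ∀ i : Fin 3,
      ∑ᶠ M ∈ {M : Submodule 𝒪[K] (Fin 3 → K) | M ∈ stratum σ ϖ T ![2 * ρ, 2 * ρ, 2 * ρ] ∧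
          (LatticeInLevel ϖ (d % 2) (Matrix.diagonal ![α - 1, β - 1, 0]) M ∧ ¬ LatticeInLevel ϖ (d % 2 + 1) (Matrix.diagonal ![α - 1, β - 1, 0]) M ∧
            LatticeInLevel ϖ (mcOfRecord d) (Matrix.diagonal ![(α - 1) * (α - 1), (β - 1) * (β - 1), 0]) M)},
        (labelledOddCount σ ϖ 0 i (valueClassLabel σ ϖ (α - 1) (β - 1) (mstarOfRecord d) d) M : ℚ) /
          ((((unitStabilizer M).map (unitNormMap σ 3)).relIndex (fixedUnitTorus σ 3) : ℕ) : ℚ) = 0 := by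
  intro h23 hlt hbd ρ hρ hloc i
  have h2d : 2 ≤ d := two_le_d_of_v_two_lt_one hD h2
  obtain ⟨hℓ, hℓ', hmcN, hmN⟩ := levels_le_n0DerivedOfRecord (d := d) (by omega)
  have key := finsum_stratum_shell_labelledOdd_div_relIndex_swap02_of hD hE hT 0 (2 * ρ) (2 * ρ) (2 * ρ) hℓ hℓ' hmcN hmN (W := Unit)
    (fun _ _ n₁' n₂' n₃' _ => n₁' = n₂' ∧ n₁' < n₃' ∧ n₃' + 4 ≤ n₁' + 2 * d ∧ 2 * ρ + d % 2 = n₁')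
    (fun _ _ _ _ _ _ _ => (0 : ℚ))
    (fun T' _ hE' hT' hHyp j => hZ₃ T' hE' hT' hHyp.1 hHyp.2.1 hHyp.2.2.1 ρ hρ hHyp.2.2.2 j)
    () ⟨h23.symm, by omega, by omega, by omega⟩ i
  rw [key]

/-! ## §4  The below-boundary zero of the placement `n₁ = n₃` from the placement `n₂ = n₃` (`(0 1)`) -/

/-- **`hZ₂` FROM THE `hZ₁` SCHEMA** (token-free): if at every element datum at the derived threshold the H row vanishes on the locus `2ρ + ℓ₀ = n₂'` of the placement `n₂' = n₃' < n₁'`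
with `n₁' + 4 ≤ n₂' + 2d`, then at `(α, β; n₁, n₂, n₃)` it vanishes on the locus `2ρ + ℓ₀ = n₁` of the placement `n₁ = n₃ < n₂` with `n₂ + 4 ≤ n₁ + 2d` — ★ p861984's `hZ₂`
binder VERBATIM (★ p861439 at `(β, α; n₂, n₁, n₃)`). [cite: Kottwitz1986BaseChangeUnits, §1 pp. 240–241] [cite: Rogawski1990, §4.9 Prop. 4.9.1 (a)(b) p. 55] -/
theorem zero₂_of_zero₁
    (hZ₁ : ∀ {α' β' : K} {n₁' n₂' n₃' : ℕ} (T' : GL (Fin 3) K), IsElementDatum σ ϖ (n0DerivedOfRecord d) α' β' n₁' n₂' n₃' →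
      (T' : Matrix (Fin 3) (Fin 3) K) = Matrix.diagonal ![α', β', 1] →
      n₂' = n₃' → n₂' < n₁' → n₁' + 4 ≤ n₂' + 2 * d → ∀ ρ : ℕ, 1 ≤ ρ → 2 * ρ + d % 2 = n₂' → ∀ i : Fin 3,
        ∑ᶠ M ∈ {M : Submodule 𝒪[K] (Fin 3 → K) | M ∈ stratum σ ϖ T' ![2 * ρ, 2 * ρ, 2 * ρ] ∧
            (LatticeInLevel ϖ (d % 2) (Matrix.diagonal ![α' - 1, β' - 1, 0]) M ∧ ¬ LatticeInLevel ϖ (d % 2 + 1) (Matrix.diagonal ![α' - 1, β' - 1, 0]) M ∧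
              LatticeInLevel ϖ (mcOfRecord d) (Matrix.diagonal ![(α' - 1) * (α' - 1), (β' - 1) * (β' - 1), 0]) M)},
          (labelledOddCount σ ϖ 0 i (valueClassLabel σ ϖ (α' - 1) (β' - 1) (mstarOfRecord d) d) M : ℚ) /
            ((((unitStabilizer M).map (unitNormMap σ 3)).relIndex (fixedUnitTorus σ 3) : ℕ) : ℚ) = 0)
    (hE : IsElementDatum σ ϖ (n0DerivedOfRecord d) α β n₁ n₂ n₃)
    (T : GL (Fin 3) K) (hT : (T : Matrix (Fin 3) (Fin 3) K) = Matrix.diagonal ![α, β, 1]) :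
    n₁ = n₃ → n₁ < n₂ → n₂ + 4 ≤ n₁ + 2 * d → ∀ ρ : ℕ, 1 ≤ ρ → 2 * ρ + d % 2 = n₁ → ∀ i : Fin 3,
      ∑ᶠ M ∈ {M : Submodule 𝒪[K] (Fin 3 → K) | M ∈ stratum σ ϖ T ![2 * ρ, 2 * ρ, 2 * ρ] ∧
          (LatticeInLevel ϖ (d % 2) (Matrix.diagonal ![α - 1, β - 1, 0]) M ∧ ¬ LatticeInLevel ϖ (d % 2 + 1) (Matrix.diagonal ![α - 1, β - 1, 0]) M ∧
            LatticeInLevel ϖ (mcOfRecord d) (Matrix.diagonal ![(α - 1) * (α - 1), (β - 1) * (β - 1), 0]) M)},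
        (labelledOddCount σ ϖ 0 i (valueClassLabel σ ϖ (α - 1) (β - 1) (mstarOfRecord d) d) M : ℚ) /
          ((((unitStabilizer M).map (unitNormMap σ 3)).relIndex (fixedUnitTorus σ 3) : ℕ) : ℚ) = 0 := by
  intro h13 hlt hbd ρ hρ hloc i
  have key := finsum_stratum_shell_labelledOdd_div_relIndex_swap01_of hE hT 0 (2 * ρ) (2 * ρ) (2 * ρ) (d % 2) (d % 2 + 1)
    (mcOfRecord d) (mstarOfRecord d) d (W := Unit)
    (fun _ _ n₁' n₂' n₃' _ => n₂' = n₃' ∧ n₂' < n₁' ∧ n₁' + 4 ≤ n₂' + 2 * d ∧ 2 * ρ + d % 2 = n₂')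
    (fun _ _ _ _ _ _ _ => (0 : ℚ))
    (fun T' _ hE' hT' hHyp j => hZ₁ T' hE' hT' hHyp.1 hHyp.2.1 hHyp.2.2.1 ρ hρ hHyp.2.2.2 j)
    () ⟨h13, hlt, hbd, hloc⟩ i
  rw [key]

end Summit.HodgeConjecture.HodgeConjecture.Cruxes.H413.F0P3cDyRamOddLabelledHangingTwins

end
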